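import Literature.NumberTheory.EllipticCurves.Sprung2017.SharpFlatPAdicLFunctionProofs
import Literature.NumberTheory.EllipticCurves.Sprung2017.MAdicLimitProofs
import Mathlib.NumberTheory.Padics.RingHoms
import HarnessLib

/-!
# The chromatic (♯/♭) limit of an integral queue sequence in `Λ = ℤ_p⟦T⟧` — Sprung's
# factorisation through `𝒞_1⋯𝒞_n`, for ANY queue sequence (Sprung 2017 Def. 1.7 / Cor. 4.4;
# Sprung 2012 Prop. 5.3, Cor. 5.6, Prop. 5.7, Def. 5.9 / 7.1): definition, existence, uniqueness

Topic `Literature/NumberTheory/EllipticCurves`, cluster `Sprung2017` (namespace = path). WHY (cross-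
ladder LITERATURE-TYPING layer D-0088(4), cell `bsd-littype`, seat `bsd-littype-11` g2; unit U3 of the
seat's programme sheet `run/shared/lean/pub/bsd-littype/staging/bsd-littype-11/SHARPFLAT-PROGRAMME.md`
for the blocked ledger item `defn-SharpFlatSelmerDualData` / stmt-BirchSwinnertonDyer-19003): Sprung's
♯/♭ objects are ALL defined by one algebraic mechanism — a *queue sequence* `(Θ_n)_n`, `Θ_n ∈ Λ_n`,
`π Θ_n = a_p Θ_{n−1} − ν Θ_{n−2}` (Sprung, Algebra Number Theory 11 (2017) 885–928 [Sprung2017],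
Def. 1.7 [corpus: paper:arxiv-1601.00010 p0009]) factors through the matrix product
`𝒞_1(1+T)⋯𝒞_n(1+T) Ã⁻¹` (Cor. 4.4: "Let `(Θ_n)_n` be a queue sequence. Then
`(Θ_n, νΘ_{n−1}) = Υ_n 𝒞_1⋯𝒞_n Ã⁻¹` for some `Υ_n ∈ Λ_n^{⊕2}`" [p0016]) and, for supersingular `p`
(`p ∣ a_p`, Sprung's "Proposition (𝔐 = 0)"), the `Υ_n` CONVERGE to a unique pair `(C♯, C♭) ∈ Λ²`.
Two printed instances: (i) the Mazur–Tate elements `θ_n` — limit `= −(L♯, L♭)`, Sprung's ♯/♭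
`p`-adic `L`-functions (Thm. 1.12; in the tree: `IsSprungPair`, `thm112_exists_isSprungPair_holds`,
`IsSprungPair.unique`); (ii) the Kurihara–Kobayashi pairing values `P_n(z) = Σ_σ (c_n^σ, z)_n σ ∈ Λ_n`
of a norm-coherent local class `z` against the Honda points `c_n` (`Tr_{n+1/n} c_{n+1} = a_p c_n −
c_{n−1}`: Sprung, J. Number Theory 132 (2012) 1483–1506 [Sprung2012], Thm. 2.2 (1)) — limit `=` the
pair of **Coleman maps** `(Col♯(z), Col♭(z))` (Sprung 2012 Prop. 5.3 "There is a unique homomorphism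
`Col_n` so that the following commutes", Cor. 5.6 "The Coleman maps are compatible", Prop. 5.7
"(Limit Proposition)", Def. 5.9 "Let the Coleman map `Col : H¹_Iw(T) → Λ ⊕ Λ` be the projective limit
of `Col_n`", Def. 7.1 "`Col =: (Col♯, Col♭)`" [corpus: paper:doi-10-1016-j-jnt-2011-11-003 p0011 L99 –
p0013 L95, p0018 L5]). The tree had the mechanism only WELDED to instance (i) (`IsSprungPair f p a_p`
quantifies over `mazurTateElement f p`; the existence proof `exists_integral_isSprungPair_of_lifts`
and the uniqueness proof `IsSprungPair.unique` use nothing about `θ_n` beyond integral lifts with the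
three-term relation). This file states it for an ARBITRARY integral queue sequence, so that instance
(ii) — the ♯/♭ Coleman maps, whence Sprung's local conditions `E♯/♭_{∞,p}` (Def. 7.9) and Selmer
groups `Sel♯/♭` (Def. 7.11) — can be DEFINED by unique existence once the pairing sequence is typed
(units U2/U4 of the programme sheet), with no further limit argument.

## Contents (definitions with bodies + PROVED theorems; no named fact, nothing asserted)

* `IsQueueSequence p ap Θ` — `Θ : ℕ → ℤ_p[T]` is an (integrally lifted) queue sequence for the trace
  `ap`: `Θ_{n+2} − a_p Θ_{n+1} + Φ_{p^{n+1}}(1+T) Θ_n ∈ ω_{n+1} ℤ_p[T]` for every `n` (Sprung 2017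
  Def. 1.7 `π Θ_n = a_p Θ_{n−1} − ν Θ_{n−2}`, lifted from `Λ_n = ℤ_p[T]/ω_n` to `ℤ_p[T]`: `π` = reduce
  mod `ω_n`, `ν : Λ_{n−1} → Λ_n` = multiplication by `ω_n/ω_{n−1} = Φ_{pⁿ}(1+T)`; Sprung 2012
  Thm. 2.2 (1) / Prop. 5.5 is this relation for the pairing values).
* `IsChromaticLimit p ap Θ C♯ C♭` — `Θ_m + u_m C♯ + v_m C♭ ∈ ω_m Λ` for every `m` (`u_m = sharpPoly`,
  `v_m = flatPoly`, the first column of `𝒞_1⋯𝒞_m Ã⁻¹`): the INTEGRAL form of the congruences of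
  `IsSprungPair` (which read `θ_m ≡ −(u_m L♯ + v_m L♭) (mod ω_m)` in `Λ ⊗ ℚ_p` for `θ_m ∈ ℚ[T]`).
* `IsChromaticLimit.unique` — UNIQUENESS for `p ∣ ap` (the argument of `IsSprungPair.unique`, whose
  Step 1 — clearing the powers of `p` — is not needed in the integral form; NO queue-sequence
  hypothesis is used); `IsChromaticLimit.chromaticL_eq`.
* bridge to instance (i): `IsChromaticLimit.isSprungPair_of_map_eq` — an integral chromatic limit of
  integral lifts of the `θ_n` IS a Sprung pair (so `exists_integral_isSprungPair_of_lifts` factors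
  through this vocabulary; that theorem is left untouched).
* EXISTENCE for `p ∣ ap` (`IsQueueSequence.exists_isChromaticLimit`, the `θ`-free core of
  `exists_integral_isSprungPair_of_lifts`), `existsUnique_isChromaticLimit` and the limit as a
  FUNCTION `IsQueueSequence.lim` (the shape in which U4 defines `(Col♯(z), Col♭(z))`) are in the
  companion file `ChromaticLimitExistsProofs.lean`.

Design: theorems only besides the two definitions; private helpers (`toIwasawa_*`,
`padicInt_eq_zero_of_forall_pow_dvd`) are COPIES of private helpers of
`SharpFlatPAdicLFunctionUniqueProofs.lean` (private there, hence not importable); axioms standard.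
References: [Sprung2017] Def. 1.7, Example 1.8, §4 Prop. 4.1 (Tandem Lemma), Obs. 4.2, Prop. 4.3,
Cor. 4.4, "Proposition (𝔐 = 0)", Thm. 1.12; [Sprung2012] Thm. 2.2, Def. 3.1, Prop. 3.9, Def. 5.1,
Prop. 5.3, Lemma 5.4, Prop. 5.5, Cor. 5.6, Prop. 5.7, Lemma 5.8, Def. 5.9, Def. 7.1;
S. Lang, *Cyclotomic Fields I–II*, Ch. 5 §1 (the `(p,T)`-adic topology of `Λ`).
-/

set_option autoImplicit false

noncomputable section

open Polynomial Literature.NumberTheory.EllipticCurves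

namespace Literature.NumberTheory.EllipticCurves.Sprung2017

variable {p : ℕ} [hp : Fact p.Prime]

/-! ### Definitions -/

section Defs

variable (p)

/-- **An integral queue sequence for the trace `ap`** (Sprung 2017, Def. 1.7, lifted to `ℤ_p[T]`):
`Θ : ℕ → ℤ_p[T]` with `Θ_{n+2} − a_p Θ_{n+1} + Φ_{p^{n+1}}(1+T)·Θ_n = ω_{n+1}·c_n` for some
`c_n ∈ ℤ_p[T]`, every `n ≥ 0` — i.e. `π Θ_{n+2} = a_p Θ_{n+1} − ν Θ_n` in `Λ_{n+1} = ℤ_p[T]/ω_{n+1}`.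
Instances: integral lifts of the Mazur–Tate elements `θ_n` (`exists_lifts_threeTerm`); the pairing
values `P_n(z)` of Sprung 2012 §3/§5 (Thm. 2.2 (1), Prop. 5.5). [cite: Sprung2017, Def. 1.7 and Example 1.8]
[cite: Sprung2012, Thm. 2.2 (1) and Prop. 5.5] -/
def IsQueueSequence (ap : ℤ) (Θ : ℕ → ℤ_[p][X]) : Prop :=
  ∀ n : ℕ, ∃ c : ℤ_[p][X],
    Θ (n + 2) - C (ap : ℤ_[p]) * Θ (n + 1) +
        ((cyclotomic (p ^ (n + 1)) ℤ).comp (X + 1)).map (Int.castRingHom ℤ_[p]) * Θ n =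
      (cyclotomicOmega p (n + 1)).map (Int.castRingHom ℤ_[p]) * c

/-- **`(C♯, C♭) ∈ Λ²` is the chromatic limit of `Θ`** (Sprung 2017 Cor. 4.4 / Sprung 2012 Prop. 5.7,
Def. 5.9, in the first-column form of the tree's `IsSprungPair`): for every `m ≥ 0`,
`Θ_m + u_m·C♯ + v_m·C♭ ∈ ω_m·Λ` in `Λ = ℤ_p⟦T⟧`, `u_m = sharpPoly ap p m`, `v_m = flatPoly ap p m`.
For `Θ_n =` lifts of `θ_n` the limit is Sprung's `(L♯, L♭)` (`isSprungPair_of_map_eq`); for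
`Θ_n = P_n(z)` it is `(Col♯(z), Col♭(z))` (Sprung 2012 Def. 7.1). A predicate; nothing asserted.
[cite: Sprung2017, Cor. 4.4] [cite: Sprung2012, Prop. 5.7 and Def. 5.9] -/
def IsChromaticLimit (ap : ℤ) (Θ : ℕ → ℤ_[p][X]) (Cs Cf : IwasawaAlgebra p) : Prop :=
  ∀ m : ℕ, ∃ Q : IwasawaAlgebra p,
    (Θ m : PowerSeries ℤ_[p]) +
        (toIwasawa p (sharpPoly ap p m) * Cs + toIwasawa p (flatPoly ap p m) * Cf) =
      ((cyclotomicOmega p m).map (Int.castRingHom ℤ_[p]) : PowerSeries ℤ_[p]) * Q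

variable {p}

/-- Unfolding lemma. [cite: Sprung2017, Def. 1.7] -/
theorem isQueueSequence_iff (ap : ℤ) (Θ : ℕ → ℤ_[p][X]) :
    IsQueueSequence p ap Θ ↔ ∀ n : ℕ, ∃ c : ℤ_[p][X],
      Θ (n + 2) - C (ap : ℤ_[p]) * Θ (n + 1) +
          ((cyclotomic (p ^ (n + 1)) ℤ).comp (X + 1)).map (Int.castRingHom ℤ_[p]) * Θ n =
        (cyclotomicOmega p (n + 1)).map (Int.castRingHom ℤ_[p]) * c :=
  Iff.rfl

/-- Unfolding lemma. [cite: Sprung2017, Cor. 4.4] -/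
theorem isChromaticLimit_iff (ap : ℤ) (Θ : ℕ → ℤ_[p][X]) (Cs Cf : IwasawaAlgebra p) :
    IsChromaticLimit p ap Θ Cs Cf ↔ ∀ m : ℕ, ∃ Q : IwasawaAlgebra p,
      (Θ m : PowerSeries ℤ_[p]) +
          (toIwasawa p (sharpPoly ap p m) * Cs + toIwasawa p (flatPoly ap p m) * Cf) =
        ((cyclotomicOmega p m).map (Int.castRingHom ℤ_[p]) : PowerSeries ℤ_[p]) * Q :=
  Iff.rfl

end Defs

/-! ### Private helpers (copies of private helpers of `SharpFlatPAdicLFunctionUniqueProofs.lean`) -/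

section Helpers

/-- `toIwasawa` = map the coefficients and coerce. [folklore] -/
private theorem toIwasawa_apply (q : ℤ[X]) :
    toIwasawa p q = ((q.map (Int.castRingHom ℤ_[p]) : ℤ_[p][X]) : PowerSeries ℤ_[p]) := rfl

/-- `toIwasawa T = T`. [folklore] -/
private theorem toIwasawa_X : toIwasawa p (X : ℤ[X]) = PowerSeries.X := by
  rw [toIwasawa_apply, Polynomial.map_X, Polynomial.coe_X]

/-- The image of the monic `Π_n = ∏_{i<n} Φ_{p^{i+1}}(1+T)` in `Λ` is non-zero. [folklore] -/
private theorem toIwasawa_prod_cyclotomic_ne_zero (n : ℕ) :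
    toIwasawa p (∏ i ∈ Finset.range n, (cyclotomic (p ^ (i + 1)) ℤ).comp (X + 1)) ≠ 0 := by
  have hmonic : (∏ i ∈ Finset.range n, (cyclotomic (p ^ (i + 1)) ℤ).comp (X + 1)).Monic := by
    refine monic_prod_of_monic _ _ fun i _ ↦ (cyclotomic.monic _ ℤ).comp (monic_X_add_C 1) ?_
    rw [← C_1, natDegree_X_add_C]
    exact one_ne_zero
  rw [toIwasawa_apply, Ne, Polynomial.coe_eq_zero_iff]
  exact (hmonic.map (Int.castRingHom ℤ_[p])).ne_zero

/-- An element of `ℤ_p` divisible by every power of `p` is `0`. [folklore] -/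
private theorem padicInt_eq_zero_of_forall_pow_dvd (x : ℤ_[p]) (h : ∀ k : ℕ, (p : ℤ_[p]) ^ k ∣ x) :
    x = 0 := by
  by_contra hx
  have hpos : 0 < ‖x‖ := norm_pos_iff.mpr hx
  have hp1 : ((p : ℝ)⁻¹) < 1 := inv_lt_one_of_one_lt₀ (by exact_mod_cast hp.out.one_lt)
  obtain ⟨k, hk⟩ := exists_pow_lt_of_lt_one hpos hp1
  have hle : ‖x‖ ≤ (p : ℝ) ^ (-(k : ℤ)) :=
    (PadicInt.norm_le_pow_iff_mem_span_pow x k).mpr (Ideal.mem_span_singleton.mpr (h k))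
  rw [zpow_neg, zpow_natCast, ← inv_pow] at hle
  exact absurd (hle.trans_lt hk) (lt_irrefl _)

end Helpers

/-! ### Uniqueness of the chromatic limit (`p ∣ a_p`) -/

section Uniqueness

/-- **The chromatic limit is unique when `p ∣ a_p`** (Sprung 2017 Thm. 1.12 "there is a UNIQUE
vector"; Sprung 2012 Prop. 5.3 "There is a unique homomorphism `Col_n`" / Def. 5.9): two chromatic
limits `(C♯, C♭)`, `(C♯', C♭')` of the same integral sequence are equal. Argument of
`IsSprungPair.unique` in `Λ`: the differences `a, b` satisfy `u_n a + v_n b ∈ ω_n Λ`; the Wronskian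
`u_{n+1}v_n − v_{n+1}u_n = ω_n/T` solves `a ∈ T·(v_n, v_{n+1})Λ`, `b ∈ T·(u_n, u_{n+1})Λ` for every
`n`, and `u_n, v_n ∈ (p,T)^{⌊n/2⌋}` forces every coefficient of `a`, `b` into `⋂_k p^k ℤ_p = 0`.
(No queue-sequence hypothesis is needed.) [cite: Sprung2017, Thm. 1.12 (uniqueness) and §4 Cor. 4.4]
[cite: Sprung2012, Prop. 5.3 and Def. 5.9] -/
theorem IsChromaticLimit.unique {ap : ℤ} (hap : (p : ℤ) ∣ ap) {Θ : ℕ → ℤ_[p][X]}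
    {A B A' B' : IwasawaAlgebra p} (h : IsChromaticLimit p ap Θ A B)
    (h' : IsChromaticLimit p ap Θ A' B') : A = A' ∧ B = B' := by
  set a : IwasawaAlgebra p := A - A' with ha_def
  set b : IwasawaAlgebra p := B - B' with hb_def
  set u : ℕ → IwasawaAlgebra p := fun n ↦ toIwasawa p (sharpPoly ap p n) with hu_def
  set v : ℕ → IwasawaAlgebra p := fun n ↦ toIwasawa p (flatPoly ap p n) with hv_def
  set Φ : ℕ → IwasawaAlgebra p := fun n ↦ toIwasawa p ((cyclotomic (p ^ n) ℤ).comp (X + 1))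
    with hΦ_def
  set Pr : ℕ → IwasawaAlgebra p :=
    fun n ↦ toIwasawa p (∏ i ∈ Finset.range n, (cyclotomic (p ^ (i + 1)) ℤ).comp (X + 1)) with hPr_def
  set Ω : ℕ → IwasawaAlgebra p :=
    fun n ↦ ((cyclotomicOmega p n).map (Int.castRingHom ℤ_[p]) : PowerSeries ℤ_[p]) with hΩ_def
  -- Step 1: integral congruences `u_n a + v_n b = Ω_n r_n` (immediate in the integral form)
  have E : ∀ n, ∃ r : IwasawaAlgebra p, u n * a + v n * b = Ω n * r := by
    intro n
    obtain ⟨Q, hQ⟩ := h n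
    obtain ⟨Q', hQ'⟩ := h' n
    refine ⟨Q - Q', ?_⟩
    simp only [hu_def, hv_def, ha_def, hb_def, hΩ_def]
    linear_combination hQ - hQ'
  choose r hr using E
  -- the Wronskian, `Ω_n = T·Π_n`, `Ω_{n+1} = Ω_n Φ_{n+1}`
  have W : ∀ n, u (n + 1) * v n - v (n + 1) * u n = Pr n := by
    intro n
    simp only [hu_def, hv_def, hPr_def, ← map_mul, ← map_sub]
    rw [sharpPoly_succ_mul_flatPoly_sub]
  have hΩ : ∀ n, Ω n = toIwasawa p X * Pr n := by
    intro n
    simp only [hΩ_def, hPr_def, ← map_mul]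
    rw [X_mul_prod_cyclotomic_comp_eq_cyclotomicOmega, toIwasawa_apply]
  have hΩsucc : ∀ n, Ω (n + 1) = Ω n * Φ (n + 1) := by
    intro n
    simp only [hΩ_def, hΦ_def]
    rw [cyclotomicOmega_succ, toIwasawa_apply, Polynomial.map_mul, Polynomial.coe_mul]
  have hPr : ∀ n, Pr n ≠ 0 := fun n ↦ toIwasawa_prod_cyclotomic_ne_zero n
  -- Step 2: elimination
  have hA : ∀ n, a = toIwasawa p X * (Φ (n + 1) * r (n + 1) * v n - r n * v (n + 1)) := by
    intro n
    apply mul_left_cancel₀ (hPr n)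
    have e1 := hr n
    have e2 := hr (n + 1)
    rw [hΩsucc, hΩ] at e2
    rw [hΩ] at e1
    linear_combination (v n) * e2 - (v (n + 1)) * e1 - a * W n
  have hB : ∀ n, b = toIwasawa p X * (r n * u (n + 1) - Φ (n + 1) * r (n + 1) * u n) := by
    intro n
    apply mul_left_cancel₀ (hPr n)
    have e1 := hr n
    have e2 := hr (n + 1)
    rw [hΩsucc, hΩ] at e2
    rw [hΩ] at e1
    linear_combination (u (n + 1)) * e1 - (u n) * e2 - b * W n
  -- Step 3: `(p,T)`-adic bounds on `u_n`, `v_n`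
  have hu : ∀ n j, (p : ℤ_[p]) ^ (n / 2 - j) ∣ PowerSeries.coeff j (u n) := by
    intro n j
    simp only [hu_def, toIwasawa_apply, Polynomial.coeff_coe]
    exact pow_dvd_coeff_map_sprungSeq hap 0 1 n j
  have hv : ∀ n j, (p : ℤ_[p]) ^ (n / 2 - j) ∣ PowerSeries.coeff j (v n) := by
    intro n j
    simp only [hv_def, toIwasawa_apply, Polynomial.coeff_coe]
    exact pow_dvd_coeff_map_sprungSeq hap 1 0 n j
  have hu' : ∀ n j, (p : ℤ_[p]) ^ (n / 2 - j) ∣ PowerSeries.coeff j (u (n + 1)) := fun n j ↦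
    (pow_dvd_pow _ (by omega)).trans (hu (n + 1) j)
  have hv' : ∀ n j, (p : ℤ_[p]) ^ (n / 2 - j) ∣ PowerSeries.coeff j (v (n + 1)) := fun n j ↦
    (pow_dvd_pow _ (by omega)).trans (hv (n + 1) j)
  have hcoeffA : ∀ n j, (p : ℤ_[p]) ^ (n / 2 - j) ∣ PowerSeries.coeff (j + 1) a := by
    intro n j
    rw [hA n, toIwasawa_X, PowerSeries.coeff_succ_X_mul, map_sub]
    exact dvd_sub (MAdic.dvd_coeff_mul_of_dvd_coeff p (hv n) _ j)
      (MAdic.dvd_coeff_mul_of_dvd_coeff p (hv' n) _ j)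
  have hcoeffB : ∀ n j, (p : ℤ_[p]) ^ (n / 2 - j) ∣ PowerSeries.coeff (j + 1) b := by
    intro n j
    rw [hB n, toIwasawa_X, PowerSeries.coeff_succ_X_mul, map_sub]
    exact dvd_sub (MAdic.dvd_coeff_mul_of_dvd_coeff p (hu' n) _ j)
      (MAdic.dvd_coeff_mul_of_dvd_coeff p (hu n) _ j)
  have hzero : ∀ x : IwasawaAlgebra p,
      (x = toIwasawa p X * (Φ 1 * r 1 * v 0 - r 0 * v 1) ∨
        x = toIwasawa p X * (r 0 * u 1 - Φ 1 * r 1 * u 0)) →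
      (∀ n j, (p : ℤ_[p]) ^ (n / 2 - j) ∣ PowerSeries.coeff (j + 1) x) → x = 0 := by
    intro x hx0 hx
    ext j
    rw [map_zero]
    cases j with
    | zero =>
      rcases hx0 with hx0 | hx0 <;>
        rw [hx0, toIwasawa_X, PowerSeries.coeff_zero_eq_constantCoeff, map_mul,
          PowerSeries.constantCoeff_X, zero_mul]
    | succ j =>
      refine padicInt_eq_zero_of_forall_pow_dvd _ fun k ↦ ?_
      have hk := hx (2 * (j + k)) j
      rwa [show 2 * (j + k) / 2 - j = k from by omega] at hk
  have ha0 : a = 0 := hzero a (Or.inl (hA 0)) hcoeffA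
  have hb0 : b = 0 := hzero b (Or.inr (hB 0)) hcoeffB
  exact ⟨sub_eq_zero.mp ha0, sub_eq_zero.mp hb0⟩

/-- Chromatic form of uniqueness: both colours agree. [cite: Sprung2017, Thm. 1.12 (uniqueness)] -/
theorem IsChromaticLimit.chromaticL_eq {ap : ℤ} (hap : (p : ℤ) ∣ ap) {Θ : ℕ → ℤ_[p][X]}
    {A B A' B' : IwasawaAlgebra p} (h : IsChromaticLimit p ap Θ A B)
    (h' : IsChromaticLimit p ap Θ A' B') (c : Chroma) : chromaticL c A B = chromaticL c A' B' := by
  obtain ⟨rfl, rfl⟩ := h.unique hap h'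
  rfl

end Uniqueness

/-! ### Bridge to the Mazur–Tate instance (`IsSprungPair`) -/

section Bridge

open scoped MatrixGroups ModularForm
open CongruenceSubgroup

variable {N : ℕ} {f : CuspForm (Gamma0 N) 2}

/-- **A chromatic limit of integral lifts of the Mazur–Tate elements is a Sprung pair**: if
`Θ_n ∈ ℤ_p[T]` maps to `θ_n = mazurTateElement f p n` in `ℚ_p[T]` and `(C♯, C♭)` is a chromatic limit
of `Θ`, then `IsSprungPair f p ap C♯ C♭` (the congruence `θ_m ≡ −(u_m C♯ + v_m C♭) (mod ω_m)` holds
in `Λ ⊗ ℚ_p` with exponent `0`). This is the last step of `exists_integral_isSprungPair_of_lifts`.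
[cite: Sprung2017, Thm. 1.12 and Cor. 4.4] -/
theorem IsChromaticLimit.isSprungPair_of_map_eq {ap : ℤ} {Θ : ℕ → ℤ_[p][X]}
    {Cs Cf : IwasawaAlgebra p} (h : IsChromaticLimit p ap Θ Cs Cf)
    (hΘ : ∀ n, (Θ n).map (algebraMap ℤ_[p] ℚ_[p]) = (mazurTateElement f p n).map (algebraMap ℚ ℚ_[p])) :
    IsSprungPair f p ap Cs Cf := by
  intro m
  obtain ⟨Q, hQ⟩ := h m
  refine ⟨0, Q, ?_⟩
  have hθ : (((mazurTateElement f p m).map (algebraMap ℚ ℚ_[p]) : ℚ_[p][X]) :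
      PowerSeries ℚ_[p]) = iwasawaToPowerSeries p (Θ m : PowerSeries ℤ_[p]) := by
    rw [← hΘ, Polynomial.polynomial_map_coe]
  have hneg : (((-1 : ℤ[X]).map (Int.castRingHom ℤ_[p]) : ℤ_[p][X]) : PowerSeries ℤ_[p]) = -1 := by
    rw [Polynomial.map_neg, Polynomial.map_one, Polynomial.coe_neg, Polynomial.coe_one]
  rw [pow_zero, map_one, one_mul, hθ, hneg, ← map_sub, neg_one_mul, sub_neg_eq_add, hQ]

end Bridge

end Literature.NumberTheory.EllipticCurves.Sprung2017

end
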